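import Summits.CriticalPhenomena.CardyFormulaZ2.Theorems.CardyComplexConeSLESixFamiliesGiveCardySmoothMarkFamiliesPart6
import HarnessLib

/-!
# Smooth-mark discretisation families, part 7: normalised frame data at a smooth mark

Helper file for stub `stub_smoothMarkFamilies` of line `collar-touch-sandwich` of crux
`SLESixFamiliesGiveCardy` (stmt-CriticalPhenomena-9654).  From `IsSmoothMark D i` (the domain is,
near `D.pt i` and after a lattice rotation, the strict epigraph of a `C²` function `g`, `g 0 = 0`,
in general position `0 < |g' 0| < 1` or exactly affine along a lattice direction) we produce the
normalised data used in parts 2–6: a lattice frame `(k, s, t)` with frame vectors `U, V`, a GLOBAL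
monotone `1`-Lipschitz `G : ℝ → ℝ`, differentiable near `α`, with `D.pt i = α U + G α V` and
`D.carrier ∩ B(D.pt i, R) = {a U + b V : G a < b} ∩ B(D.pt i, R)` (`exists_frame_of_isSmoothMark`).
Monotonicity comes from the sign of `g'` near `0` (or the affine form), after a reflection of the
abscissa if `g` decreases; the Lipschitz bound from `|g'| < 1`; globality by clamping the argument.
-/

noncomputable section

open Set Metric
open Literature.Probability Literature.Probability.RandomPlanarGeometry
  Literature.Probability.LatticeModels Literature.Probability.Percolation

namespace Summit.CriticalPhenomena.CardyFormulaZ2.Cruxes.SLESixFamiliesGiveCardy.CollarTouchSandwich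

namespace SmoothMark

/-! ### Local monotone reparametrisation of the graph function -/

/-- **Monotone reparametrisation.** Under the general-position-or-affine hypothesis of
`IsSmoothMark`, after possibly reflecting the abscissa (`σ = -1`) the function `x ↦ g (σ x)` is
monotone and `1`-Lipschitz on a small interval `[-ρ, ρ]` and differentiable inside it. [folklore] -/
theorem exists_monotone_reparam {g : ℝ → ℝ} {r : ℝ} (hr : 0 < r) (hg : ContDiffOn ℝ 2 g (Ioo (-r) r))
    (hcase : (0 < |deriv g 0| ∧ |deriv g 0| < 1) ∨ ∃ c : ℝ, (c = 0 ∨ c = 1 ∨ c = -1) ∧ ∀ t, g t = c * t) :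
    ∃ (σ : ℤ) (ρ : ℝ), (σ = 1 ∨ σ = -1) ∧ 0 < ρ ∧ ρ < r ∧
      MonotoneOn (fun x => g (σ * x)) (Icc (-ρ) ρ) ∧
      (∀ x ∈ Icc (-ρ) ρ, ∀ y ∈ Icc (-ρ) ρ, |g (σ * x) - g (σ * y)| ≤ |x - y|) ∧
      (∀ x, |x| < ρ → DifferentiableAt ℝ (fun x => g (σ * x)) x) := by
  rcases hcase with ⟨h0, h1⟩ | ⟨c, hc, hgc⟩
  · -- general position
    have hdiff : DifferentiableOn ℝ g (Ioo (-r) r) := hg.differentiableOn (by norm_num)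
    have hcont : ContinuousOn (deriv g) (Ioo (-r) r) := hg.continuousOn_deriv_of_isOpen isOpen_Ioo (by norm_num)
    have h0mem : (0 : ℝ) ∈ Ioo (-r) r := ⟨by linarith, hr⟩
    have hda : ∀ x ∈ Ioo (-r) r, DifferentiableAt ℝ g x := fun x hx =>
      hdiff.differentiableAt (Ioo_mem_nhds hx.1 hx.2)
    set m : ℝ := min |deriv g 0| (1 - |deriv g 0|) / 2 with hm
    have hm0 : 0 < m := by
      rw [hm]; exact div_pos (lt_min h0 (by linarith)) two_pos
    obtain ⟨ρ₀, hρ₀, hρ₀'⟩ := Metric.continuousAt_iff.1 (hcont.continuousAt (Ioo_mem_nhds h0mem.1 h0mem.2)) m hm0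
    set ρ : ℝ := min (ρ₀ / 2) (r / 2) with hρ
    have hρ0 : 0 < ρ := lt_min (by linarith) (by linarith)
    have hρr : ρ < r := (min_le_right _ _).trans_lt (by linarith)
    have hρρ₀ : ρ < ρ₀ := (min_le_left _ _).trans_lt (by linarith)
    -- derivative control on `[-ρ, ρ]`
    have hder : ∀ x ∈ Icc (-ρ) ρ, |deriv g x - deriv g 0| < m ∧ x ∈ Ioo (-r) r := by
      intro x hx
      have hxr : x ∈ Ioo (-r) r := ⟨by linarith [hx.1], by linarith [hx.2]⟩
      refine ⟨?_, hxr⟩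
      have := hρ₀' (x := x) (by rw [Real.dist_eq, sub_zero]; exact (abs_le.2 ⟨hx.1, hx.2⟩).trans_lt hρρ₀)
      rwa [Real.dist_eq] at this
    have hm1 : m ≤ |deriv g 0| / 2 := by
      rw [hm]; exact div_le_div_of_nonneg_right (min_le_left _ _) two_pos.le
    have hm2 : m ≤ (1 - |deriv g 0|) / 2 := by
      rw [hm]; exact div_le_div_of_nonneg_right (min_le_right _ _) two_pos.le
    have hlt1 : ∀ x ∈ Icc (-ρ) ρ, |deriv g x| < 1 := by
      intro x hx
      have := (hder x hx).1
      have := abs_sub_abs_le_abs_sub (deriv g x) (deriv g 0)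
      linarith
    have hlipg : ∀ x ∈ Icc (-ρ) ρ, ∀ y ∈ Icc (-ρ) ρ, |g x - g y| ≤ |x - y| := by
      intro x hx y hy
      have := (convex_Icc (-ρ) ρ).norm_image_sub_le_of_norm_deriv_le (f := g) (C := 1)
        (fun z hz => hda z (hder z hz).2) (fun z hz => by
          rw [Real.norm_eq_abs]; exact (hlt1 z hz).le) hy hx
      simpa using this
    have hcg : ContinuousOn g (Icc (-ρ) ρ) := fun x hx => (hda x (hder x hx).2).continuousAt.continuousWithinAt
    have hdg : DifferentiableOn ℝ g (interior (Icc (-ρ) ρ)) := by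
      rw [interior_Icc]; exact fun x hx => (hda x (hder x (Ioo_subset_Icc_self hx)).2).differentiableWithinAt
    rcases lt_or_gt_of_ne (abs_pos.1 h0) with hneg | hpos
    · -- `g' 0 < 0`: reflect
      refine ⟨-1, ρ, Or.inr rfl, hρ0, hρr, ?_, ?_, ?_⟩
      · have hanti : AntitoneOn g (Icc (-ρ) ρ) := by
          refine antitoneOn_of_deriv_nonpos (convex_Icc _ _) hcg hdg fun x hx => ?_
          rw [interior_Icc] at hx
          have := (hder x (Ioo_subset_Icc_self hx)).1
          rw [abs_of_neg hneg] at hm1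
          have := abs_lt.1 this
          linarith
        intro x hx y hy hxy
        push_cast
        simp only [neg_mul, one_mul]
        exact hanti ⟨by linarith [hy.2], by linarith [hy.1]⟩ ⟨by linarith [hx.2], by linarith [hx.1]⟩
          (neg_le_neg hxy)
      · intro x hx y hy
        push_cast
        simp only [neg_mul, one_mul]
        have := hlipg (-x) ⟨by linarith [hx.2], by linarith [hx.1]⟩ (-y) ⟨by linarith [hy.2], by linarith [hy.1]⟩
        rwa [show -x - -y = -(x - y) by ring, abs_neg] at this
      · intro x hx
        push_cast
        have hxr : -x ∈ Ioo (-r) r := by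
          have := abs_lt.1 hx; constructor <;> linarith
        have e : (fun x : ℝ => g (-1 * x)) = g ∘ (fun x => -x) := by funext y; simp
        rw [e]; exact (hda (-x) hxr).comp x (by fun_prop)
    · -- `0 < g' 0`
      refine ⟨1, ρ, Or.inl rfl, hρ0, hρr, ?_, ?_, ?_⟩
      · have hmono : MonotoneOn g (Icc (-ρ) ρ) := by
          refine monotoneOn_of_deriv_nonneg (convex_Icc _ _) hcg hdg fun x hx => ?_
          rw [interior_Icc] at hx
          have := (hder x (Ioo_subset_Icc_self hx)).1
          rw [abs_of_pos hpos] at hm1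
          have := abs_lt.1 this
          linarith
        intro x hx y hy hxy
        push_cast
        simp only [one_mul]
        exact hmono hx hy hxy
      · intro x hx y hy
        push_cast
        simp only [one_mul]
        exact hlipg x hx y hy
      · intro x hx
        push_cast
        simp only [one_mul]
        have hxr : x ∈ Ioo (-r) r := by
          have := abs_lt.1 hx; constructor <;> linarith
        exact hda x hxr
  · -- affine along a lattice direction
    have key : ∀ σ : ℤ, (σ = 1 ∨ σ = -1) → 0 ≤ c * σ → c * σ ≤ 1 →
        ∃ (σ : ℤ) (ρ : ℝ), (σ = 1 ∨ σ = -1) ∧ 0 < ρ ∧ ρ < r ∧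
          MonotoneOn (fun x => g (σ * x)) (Icc (-ρ) ρ) ∧
          (∀ x ∈ Icc (-ρ) ρ, ∀ y ∈ Icc (-ρ) ρ, |g (σ * x) - g (σ * y)| ≤ |x - y|) ∧
          (∀ x, |x| < ρ → DifferentiableAt ℝ (fun x => g (σ * x)) x) := by
      intro σ hσ h0 h1
      have hg' : (fun x => g (σ * x)) = fun x => (c * σ) * x := by
        funext x; rw [hgc]; ring
      refine ⟨σ, r / 2, hσ, by linarith, by linarith, ?_, ?_, ?_⟩
      · rw [hg']; exact fun x _ y _ hxy => mul_le_mul_of_nonneg_left hxy h0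
      · intro x _ y _
        rw [hgc, hgc, show c * (σ * x) - c * (σ * y) = (c * σ) * (x - y) by ring, abs_mul,
          abs_of_nonneg h0]
        exact mul_le_of_le_one_left (abs_nonneg _) h1
      · intro x _; rw [hg']; fun_prop
    rcases hc with rfl | rfl | rfl
    · exact key 1 (Or.inl rfl) (by simp) (by simp)
    · exact key 1 (Or.inl rfl) (by simp) (by simp)
    · exact key (-1) (Or.inr rfl) (by simp) (by simp)

/-- **Clamping.** A function monotone, `1`-Lipschitz on `[-ρ, ρ]` and differentiable inside
extends (by freezing the argument outside `[-ρ, ρ]`) to a globally monotone `1`-Lipschitz function,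
still differentiable inside. [folklore] -/
theorem exists_global_extension {g₁ : ℝ → ℝ} {ρ : ℝ} (hρ : 0 < ρ) (hmono : MonotoneOn g₁ (Icc (-ρ) ρ))
    (hlip : ∀ x ∈ Icc (-ρ) ρ, ∀ y ∈ Icc (-ρ) ρ, |g₁ x - g₁ y| ≤ |x - y|)
    (hdiff : ∀ x, |x| < ρ → DifferentiableAt ℝ g₁ x) :
    ∃ G₀ : ℝ → ℝ, Monotone G₀ ∧ (∀ x y, |G₀ x - G₀ y| ≤ |x - y|) ∧
      (∀ x, |x| < ρ → DifferentiableAt ℝ G₀ x) ∧ ∀ x, |x| ≤ ρ → G₀ x = g₁ x := by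
  set cl : ℝ → ℝ := fun x => max (-ρ) (min ρ x) with hcl
  have hclm : ∀ x, cl x ∈ Icc (-ρ) ρ := fun x =>
    ⟨le_max_left _ _, max_le (by linarith) (min_le_left _ _)⟩
  have hclid : ∀ x, |x| ≤ ρ → cl x = x := fun x hx => by
    have := abs_le.1 hx
    simp only [hcl]; rw [min_eq_right this.2, max_eq_right this.1]
  have hcllip : LipschitzWith 1 cl := (LipschitzWith.id.const_min ρ).const_max (-ρ)
  refine ⟨fun x => g₁ (cl x), fun x y hxy => hmono (hclm x) (hclm y) ?_, fun x y => ?_, fun x hx => ?_,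
    fun x hx => by show g₁ (cl x) = g₁ x; rw [hclid x hx]⟩
  · exact max_le_max le_rfl (min_le_min le_rfl hxy)
  · refine (hlip _ (hclm x) _ (hclm y)).trans ?_
    have := hcllip.dist_le_mul x y
    rwa [NNReal.coe_one, one_mul, Real.dist_eq, Real.dist_eq] at this
  · have hev : (fun x => g₁ (cl x)) =ᶠ[nhds x] g₁ := by
      have hopen : IsOpen {y : ℝ | |y| < ρ} := isOpen_lt continuous_abs continuous_const
      filter_upwards [hopen.mem_nhds hx] with y hy
      show g₁ (cl y) = g₁ y; rw [hclid y (le_of_lt hy)]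
    exact hev.differentiableAt_iff.2 (hdiff x hx)

/-! ### Frame data at a smooth mark -/

/-- The eight lattice frames: for `e ∈ {1, i, -1, -i}` and a sign `σ` there is a frame `(k, s, t)`
with frame vectors `σ e` and `i e`. [folklore] -/
theorem exists_lattice_frame {e : ℂ} (he : e = 1 ∨ e = Complex.I ∨ e = -1 ∨ e = -Complex.I) {σ : ℤ}
    (hσ : σ = 1 ∨ σ = -1) : ∃ (k : Fin 2) (s t : ℤ), (s = 1 ∨ s = -1) ∧ (t = 1 ∨ t = -1) ∧
      Site.toComplex (Pi.single k s) = (σ : ℂ) * e ∧ Site.toComplex (Pi.single k.rev t) = Complex.I * e := by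
  rcases he with rfl | rfl | rfl | rfl <;> rcases hσ with rfl | rfl
  · exact ⟨0, 1, 1, Or.inl rfl, Or.inl rfl, by simp [Site.toComplex, Complex.ext_iff],
      by simp [Site.toComplex, Complex.ext_iff]⟩
  · exact ⟨0, -1, 1, Or.inr rfl, Or.inl rfl, by simp [Site.toComplex, Complex.ext_iff],
      by simp [Site.toComplex, Complex.ext_iff]⟩
  · exact ⟨1, 1, -1, Or.inl rfl, Or.inr rfl, by simp [Site.toComplex, Complex.ext_iff],
      by simp [Site.toComplex, Complex.ext_iff]⟩
  · exact ⟨1, -1, -1, Or.inr rfl, Or.inr rfl, by simp [Site.toComplex, Complex.ext_iff],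
      by simp [Site.toComplex, Complex.ext_iff]⟩
  · exact ⟨0, -1, -1, Or.inr rfl, Or.inr rfl, by simp [Site.toComplex, Complex.ext_iff],
      by simp [Site.toComplex, Complex.ext_iff]⟩
  · exact ⟨0, 1, -1, Or.inl rfl, Or.inr rfl, by simp [Site.toComplex, Complex.ext_iff],
      by simp [Site.toComplex, Complex.ext_iff]⟩
  · exact ⟨1, -1, 1, Or.inr rfl, Or.inl rfl, by simp [Site.toComplex, Complex.ext_iff],
      by simp [Site.toComplex, Complex.ext_iff]⟩
  · exact ⟨1, 1, 1, Or.inl rfl, Or.inl rfl, by simp [Site.toComplex, Complex.ext_iff],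
      by simp [Site.toComplex, Complex.ext_iff]⟩

/-- **Normalised frame data at a smooth mark.** If `D.pt i` is a smooth mark, there are a lattice
frame `(k, s, t)` with frame vectors `U, V`, a global monotone `1`-Lipschitz `G`, reals `α` and
`R > 0` such that `D.pt i = α U + G α V`, the domain coincides inside `B(D.pt i, R)` with the strict
epigraph `{a U + b V : G a < b}`, and `G` is differentiable at every `c` with `|c - α| < R`.
[folklore] -/
theorem exists_frame_of_isSmoothMark (D : DobrushinDomain) (i : Fin 2) (h : IsSmoothMark D i) :
    ∃ (k : Fin 2) (s t : ℤ) (U V : ℂ) (G : ℝ → ℝ) (α R : ℝ),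
      (s = 1 ∨ s = -1) ∧ (t = 1 ∨ t = -1) ∧ U = Site.toComplex (Pi.single k s) ∧
      V = Site.toComplex (Pi.single k.rev t) ∧ D.pt i = (α : ℂ) * U + ((G α : ℝ) : ℂ) * V ∧ 0 < R ∧
      Monotone G ∧ (∀ a b, |G a - G b| ≤ |a - b|) ∧
      (∀ a b : ℝ, dist ((a : ℂ) * U + (b : ℂ) * V) (D.pt i) < R →
        ((a : ℂ) * U + (b : ℂ) * V ∈ D.carrier ↔ G a < b)) ∧
      (∀ c, |c - α| < R → DifferentiableAt ℝ G c) := by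
  obtain ⟨e, g, r, he, hr, hg, hg0, hcase, hloc⟩ := h
  obtain ⟨σ, ρ, hσ, hρ0, hρr, hmono₁, hlip₁, hdiff₁⟩ := exists_monotone_reparam hr hg hcase
  obtain ⟨G₀, hG₀m, hG₀l, hG₀d, hG₀eq⟩ := exists_global_extension hρ0 hmono₁ hlip₁ hdiff₁
  obtain ⟨k, s, t, hs, ht, hU, hV⟩ := exists_lattice_frame he hσ
  have hσ2 : (σ : ℝ) * σ = 1 := by rcases hσ with rfl | rfl <;> norm_num
  set U : ℂ := (σ : ℂ) * e with hUd
  set V : ℂ := Complex.I * e with hVd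
  set p : ℂ := D.pt i with hpd
  set α : ℝ := (p * (starRingEnd ℂ) U).re with hα
  set β : ℝ := (p * (starRingEnd ℂ) V).re with hβ
  have hpαβ : p = (α : ℂ) * U + (β : ℂ) * V := eq_frame_coords hs ht hU.symm hV.symm p
  set G : ℝ → ℝ := fun a => β + G₀ (a - α) with hG
  have hG00 : G₀ 0 = 0 := by
    rw [hG₀eq 0 (by rw [abs_zero]; exact hρ0.le)]; simp [hg0]
  have hGα : G α = β := by simp [hG, hG00]
  refine ⟨k, s, t, U, V, G, α, ρ, hs, ht, hU.symm, hV.symm, ?_, hρ0, ?_, ?_, ?_, ?_⟩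
  · rw [hGα]; exact hpαβ
  · intro a b hab
    simp only [hG]
    linarith [hG₀m (sub_le_sub_right hab α)]
  · intro a b
    simp only [hG]
    have := hG₀l (a - α) (b - α)
    rw [show a - α - (b - α) = a - b by ring] at this
    rwa [show β + G₀ (a - α) - (β + G₀ (b - α)) = G₀ (a - α) - G₀ (b - α) by ring]
  · intro a b hd
    -- the rotated coordinates `w` with `a U + b V = p + e w`
    set w : ℂ := ((σ * (a - α) : ℝ) : ℂ) + ((b - β : ℝ) : ℂ) * Complex.I with hw
    have hwre : w.re = σ * (a - α) := by simp [hw]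
    have hwim : w.im = b - β := by simp [hw]
    have hzw : (a : ℂ) * U + (b : ℂ) * V = p + e * w := by
      rw [hpαβ, hw, hUd, hVd]; push_cast; ring
    have hnorm : ‖w‖ ^ 2 = (a - α) ^ 2 + (b - β) ^ 2 := by
      rw [Complex.sq_norm, Complex.normSq_apply, hwre, hwim]; nlinarith [hσ2]
    have hdist : dist ((a : ℂ) * U + (b : ℂ) * V) p ^ 2 = (a - α) ^ 2 + (b - β) ^ 2 := by
      rw [hpαβ]; exact dist_sq_frame hs ht hU.symm hV.symm a b α β
    have hwρ : ‖w‖ < ρ := by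
      refine lt_of_pow_lt_pow_left₀ 2 hρ0.le ?_
      rw [hnorm, ← hdist]; exact pow_lt_pow_left₀ hd dist_nonneg two_ne_zero
    have haα : |a - α| ≤ ρ := by
      refine abs_le_of_sq_le_sq ?_ hρ0.le
      nlinarith [hnorm, sq_nonneg (b - β), norm_nonneg w, hwρ]
    have key := hloc w (hwρ.trans hρr)
    rw [← hzw, hwre, hwim] at key
    rw [key]
    simp only [hG]
    rw [hG₀eq (a - α) haα]
    constructor <;> intro h' <;> linarith
  · intro c hc
    have h1 : DifferentiableAt ℝ (fun a : ℝ => a - α) c := by fun_prop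
    have h2 : DifferentiableAt ℝ G₀ ((fun a : ℝ => a - α) c) := hG₀d _ hc
    exact (h2.comp c h1).const_add β

/-- **The band above a smooth mark.** With frame data as in `exists_frame_of_isSmoothMark`, the
compact band `{a U + b V : |a - α| ≤ R/4, 3R/8 ≤ b - G α ≤ R/2}` lies in the domain. [folklore] -/
theorem band_subset_carrier (D : DobrushinDomain) (i : Fin 2) {k : Fin 2} {s t : ℤ} {U V : ℂ}
    {G : ℝ → ℝ} {α R : ℝ} (hs : s = 1 ∨ s = -1) (ht : t = 1 ∨ t = -1)
    (hU : U = Site.toComplex (Pi.single k s)) (hV : V = Site.toComplex (Pi.single k.rev t))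
    (hp : D.pt i = (α : ℂ) * U + ((G α : ℝ) : ℂ) * V) (hR : 0 < R) (hlip : ∀ a b, |G a - G b| ≤ |a - b|)
    (hepi : ∀ a b : ℝ, dist ((a : ℂ) * U + (b : ℂ) * V) (D.pt i) < R →
      ((a : ℂ) * U + (b : ℂ) * V ∈ D.carrier ↔ G a < b)) :
    IsCompact ((fun q : ℝ × ℝ => (q.1 : ℂ) * U + (q.2 : ℂ) * V) ''
        (Icc (α - R / 4) (α + R / 4) ×ˢ Icc (G α + 3 * R / 8) (G α + R / 2))) ∧
      (fun q : ℝ × ℝ => (q.1 : ℂ) * U + (q.2 : ℂ) * V) ''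
        (Icc (α - R / 4) (α + R / 4) ×ˢ Icc (G α + 3 * R / 8) (G α + R / 2)) ⊆ D.carrier := by
  refine ⟨(isCompact_Icc.prod isCompact_Icc).image (by fun_prop), ?_⟩
  rintro _ ⟨⟨a, b⟩, ⟨⟨ha1, ha2⟩, hb1, hb2⟩, rfl⟩
  dsimp only
  have hd : dist ((a : ℂ) * U + (b : ℂ) * V) (D.pt i) < R := by
    refine lt_of_pow_lt_pow_left₀ 2 hR.le ?_
    rw [hp, dist_sq_frame hs ht hU hV]
    nlinarith
  refine (hepi a b hd).2 ?_
  have := abs_le.1 ((hlip a α).trans (abs_le.2 ⟨by linarith, by linarith⟩ : |a - α| ≤ R / 4))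
  linarith

end SmoothMark

/-! ### Registered sub-goal (one-line signature, verbatim) -/

/-- **Registered sub-goal `smoothMark_part7` of `stub_smoothMarkFamilies`**: normalised lattice-frame epigraph data at a smooth mark. [folklore] -/
theorem smoothMark_part7 : ∀ (D : DobrushinDomain) (i : Fin 2), IsSmoothMark D i → ∃ (k : Fin 2) (s t : ℤ) (U V : ℂ) (G : ℝ → ℝ) (α R : ℝ), (s = 1 ∨ s = -1) ∧ (t = 1 ∨ t = -1) ∧ U = Site.toComplex (Pi.single k s) ∧ V = Site.toComplex (Pi.single k.rev t) ∧ D.pt i = (α : ℂ) * U + ((G α : ℝ) : ℂ) * V ∧ 0 < R ∧ Monotone G ∧ (∀ a b, |G a - G b| ≤ |a - b|) ∧ (∀ a b : ℝ, dist ((a : ℂ) * U + (b : ℂ) * V) (D.pt i) < R → ((a : ℂ) * U + (b : ℂ) * V ∈ D.carrier ↔ G a < b)) ∧ (∀ c, |c - α| < R → DifferentiableAt ℝ G c) :=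
  fun D i h => SmoothMark.exists_frame_of_isSmoothMark D i h

end Summit.CriticalPhenomena.CardyFormulaZ2.Cruxes.SLESixFamiliesGiveCardy.CollarTouchSandwich

end
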